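import Literature.AlgebraicGeometry.AbelianVarieties.HomogeneousSymmetricDivisorTwoTorsion
import Literature.AlgebraicGeometry.AbelianSchemes.AbelianSchemeFibreHom
import HarnessLib

/-!
# Symmetric divisor classes are stable under pull-back along homomorphisms and under multiples (Mumford §8 (iii); GW II 27.185)

Layer `Literature/AlgebraicGeometry/AbelianVarieties`, namespace `Literature.AlgebraicGeometry.AbelianVarieties`.
THEOREMS ONLY (no definition, no named fact, no instance, no `sorry`).

A Cartier divisor (class) `Θ` on an abelian variety `X` is SYMMETRIC when `(−1)^*Θ ∼ Θ`; the cell's (X-amp) files spell this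
`(Θ.classPullback ((𝟙 X.X)⁻¹).left).LinEquiv Θ` ((−1) = the inverse of `𝟙` in the group `Hom(X, X)` of the group object), the
older tree files `(Θ.pullback (Hom.toSchemeHom (-𝟙 X))).LinEquiv Θ` ([GortzWedhorn2023] Def./Rem. 27.185 «`𝓛 = [-1]^*𝓛`»).

* `AbelianVariety.isIso_inv_left`, `AbelianVariety.inv_left_comp_toSchemeHom` — the inversion is an iso; homomorphisms commute with inversion: `(−1)_X ≫ f = f ≫ (−1)_Y`;
* **`symmetric_pullback_toSchemeHom`** — the pull-back `f^*Θ` of a symmetric class along a (dominant) HOMOMORPHISM `f : X → Y` is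
  symmetric;
* **`symmetric_nsmul`**, `symmetric_add` — multiples and sums of symmetric classes are symmetric;
* `symmetric_iff_pullback_neg_id_linEquiv` — the two spellings agree;
* **`AbelianSchemeOver.symmetric_nsmul_pullback_fibreHom`** — the shape consumed by the cell's (X-amp-2)/(X-amp-3) wrapper: for a
  homomorphism `π : B → A′` of abelian schemes over `S` and a symmetric `Θ′` on the fibre `A′_s`, `n • (π_s)^*Θ′` is symmetric on `B_s`.

All proofs are one-line computations in `Ȟ¹(X, 𝒪_X^×)` (★ `cechClass_classPullback`, ★ `cechClass_pullback`, ★ `CechPic.pullback_comp`,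
★ `cechClass_smul'`).  Cell `hodgecm-mathlib` (D-0151), Hecke-link socket (B), (X-amp) hand (h1) companion: the `hΘ₀sym` input of ★
`exists_isAmple_isLambdaOfAt_of_symmetric_witnesses` for `Θ₀ := ν • φ_d^*Θ′_sym`.  Count-neutral; HC_CM is proved only modulo the 7
printed citations until rung 0 closes.

## References
* [MumfordAV1970] D. Mumford, *Abelian Varieties* (1970), §8 (ii)–(iv) (pp. 74–75) (symmetric sheaves, `(−1)^*`).
* [GortzWedhorn2023] U. Görtz, T. Wedhorn, *Algebraic Geometry II* (2023), Def./Rem. 27.185 (p. 674) (symmetric line bundles).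
-/

set_option autoImplicit false

noncomputable section

universe u

open CategoryTheory CategoryTheory.Limits AlgebraicGeometry
open scoped MonObj

namespace Literature.AlgebraicGeometry.AbelianVarieties

open Literature.AlgebraicGeometry.Motives Literature.AlgebraicGeometry.Modules
open Literature.AlgebraicGeometry.AbelianSchemes Literature.AlgebraicGeometry.AbelianSchemes.AbelianSchemeOver

variable {K : Type u} [Field K] {X Y : AbelianVariety K}

/-- The inversion `((𝟙 X)⁻¹).left` of an abelian variety is an isomorphism of schemes (it is `[-1]`, ★ `zsmulPt_neg_one_eq_inv`).
[cite: GortzWedhorn2023, Def./Rem. 27.185 (p. 674)] -/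
theorem AbelianVariety.isIso_inv_left (X : AbelianVariety K) : IsIso (((𝟙 X.X)⁻¹ : X.X ⟶ X.X).left) := by
  rw [← X.zsmulPt_neg_one_eq_inv]; infer_instance

/-- **Homomorphisms commute with inversion**: `(−1)_X ≫ f = f ≫ (−1)_Y` on underlying schemes (`(𝟙)⁻¹ ≫ f = f⁻¹ = f ≫ (𝟙)⁻¹` in the
group `Hom(X, Y)`; Mathlib `GrpObj.inv_comp` / `GrpObj.comp_inv`). [cite: MumfordAV1970, §4 (Cor. 1 of the rigidity lemma) and §8 (pp. 74–75)] -/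
theorem AbelianVariety.inv_left_comp_toSchemeHom (f : X ⟶ Y) :
    ((𝟙 X.X)⁻¹ : X.X ⟶ X.X).left ≫ AbelianVariety.Hom.toSchemeHom f =
      AbelianVariety.Hom.toSchemeHom f ≫ ((𝟙 Y.X)⁻¹ : Y.X ⟶ Y.X).left := by
  have h : ((𝟙 X.X)⁻¹ : X.X ⟶ X.X) ≫ f.hom.hom.hom = f.hom.hom.hom ≫ ((𝟙 Y.X)⁻¹ : Y.X ⟶ Y.X) := by
    rw [GrpObj.inv_comp, GrpObj.comp_inv, Category.id_comp, Category.comp_id]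
  exact congrArg CommaMorphism.left h

/-- **The pull-back of a SYMMETRIC class along a dominant homomorphism is symmetric**: if `(−1)^*Θ ∼ Θ` on `Y` and `f : X → Y` is a
homomorphism with dominant underlying map, then `(−1)^*(f^*Θ) ∼ f^*Θ` on `X` (`(−1)_X ≫ f = f ≫ (−1)_Y` in `Ȟ¹`).
[cite: MumfordAV1970, §8 (ii)–(iv) (pp. 74–75)] [cite: GortzWedhorn2023, Rem. 27.185 (p. 674)] -/
theorem symmetric_pullback_toSchemeHom (f : X ⟶ Y) [IsDominant (AbelianVariety.Hom.toSchemeHom f)]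
    {Θ : CartierDivisor Y.X.left} (hΘ : (Θ.classPullback ((𝟙 Y.X)⁻¹ : Y.X ⟶ Y.X).left).LinEquiv Θ) :
    ((Θ.pullback (AbelianVariety.Hom.toSchemeHom f)).classPullback ((𝟙 X.X)⁻¹ : X.X ⟶ X.X).left).LinEquiv
      (Θ.pullback (AbelianVariety.Hom.toSchemeHom f)) := by
  haveI := AbelianVariety.isIso_inv_left X; haveI := AbelianVariety.isIso_inv_left Y
  rw [← CartierDivisor.cechClass_eq_iff_linEquiv, CartierDivisor.cechClass_classPullback] at hΘ
  rw [← CartierDivisor.cechClass_eq_iff_linEquiv, CartierDivisor.cechClass_classPullback, CartierDivisor.cechClass_pullback,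
    ← CechPic.pullback_comp, AbelianVariety.inv_left_comp_toSchemeHom, CechPic.pullback_comp, hΘ]

/-- **Multiples of a symmetric class are symmetric**: `(−1)^*(n•Θ) ∼ n•Θ` (`[n•Θ] = [Θ]^n` in `Ȟ¹`, ★ `cechClass_smul'`).
[cite: MumfordAV1970, §8 (ii)–(iv) (pp. 74–75)] [cite: GortzWedhorn2023, Rem. 27.185 (p. 674)] -/
theorem symmetric_nsmul {Θ : CartierDivisor X.X.left} (hΘ : (Θ.classPullback ((𝟙 X.X)⁻¹ : X.X ⟶ X.X).left).LinEquiv Θ)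
    (n : ℕ) : (((n • Θ).classPullback ((𝟙 X.X)⁻¹ : X.X ⟶ X.X).left)).LinEquiv (n • Θ) := by
  haveI := AbelianVariety.isIso_inv_left X
  rw [← CartierDivisor.cechClass_eq_iff_linEquiv, CartierDivisor.cechClass_classPullback] at hΘ
  rw [← CartierDivisor.cechClass_eq_iff_linEquiv, CartierDivisor.cechClass_classPullback, cechClass_smul', map_pow, hΘ]

/-- **Sums of symmetric classes are symmetric**: `(−1)^*(Θ₁ + Θ₂) ∼ Θ₁ + Θ₂`.
[cite: MumfordAV1970, §8 (ii)–(iv) (pp. 74–75)] -/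
theorem symmetric_add {Θ₁ Θ₂ : CartierDivisor X.X.left}
    (h₁ : (Θ₁.classPullback ((𝟙 X.X)⁻¹ : X.X ⟶ X.X).left).LinEquiv Θ₁)
    (h₂ : (Θ₂.classPullback ((𝟙 X.X)⁻¹ : X.X ⟶ X.X).left).LinEquiv Θ₂) :
    (((Θ₁ + Θ₂).classPullback ((𝟙 X.X)⁻¹ : X.X ⟶ X.X).left)).LinEquiv (Θ₁ + Θ₂) := by
  haveI := AbelianVariety.isIso_inv_left X
  rw [← CartierDivisor.cechClass_eq_iff_linEquiv, CartierDivisor.cechClass_classPullback] at h₁ h₂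
  rw [← CartierDivisor.cechClass_eq_iff_linEquiv, CartierDivisor.cechClass_classPullback, CartierDivisor.cechClass_add, map_mul,
    h₁, h₂]

/-- **The two spellings of «symmetric» agree**: class pull-back along the group inverse `((𝟙 X.X)⁻¹).left` versus pull-back
along `[-1] = Hom.toSchemeHom (-𝟙 X)` (★ `zsmulPt_neg_one_eq_inv`, ★ `zsmulPt_neg_one_left`, ★ `classPullback_linEquiv_pullback`).
[cite: GortzWedhorn2023, Def./Rem. 27.185 (p. 674)] -/
theorem symmetric_iff_pullback_neg_id_linEquiv (Θ : CartierDivisor X.X.left) :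
    (Θ.classPullback ((𝟙 X.X)⁻¹ : X.X ⟶ X.X).left).LinEquiv Θ ↔
      (Θ.pullback (AbelianVariety.Hom.toSchemeHom (-𝟙 X))).LinEquiv Θ := by
  have he : ((𝟙 X.X)⁻¹ : X.X ⟶ X.X).left = AbelianVariety.Hom.toSchemeHom (-𝟙 X) := by
    rw [← X.zsmulPt_neg_one_eq_inv, X.zsmulPt_neg_one_left]
  rw [CartierDivisor.classPullback_congr he]
  exact ⟨fun h => (Θ.classPullback_linEquiv_pullback _).symm.trans h,
    fun h => (Θ.classPullback_linEquiv_pullback _).trans h⟩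

end Literature.AlgebraicGeometry.AbelianVarieties

/-! ### The (X-amp-2) shape: `n • π_s^*Θ′` on the fibre `B_s` of an abelian scheme -/

namespace Literature.AlgebraicGeometry.AbelianSchemes.AbelianSchemeOver

open Literature.AlgebraicGeometry.Motives Literature.AlgebraicGeometry.AbelianVarieties

variable {S : Scheme.{u}} {B A' : AbelianSchemeOver S} (π : B.X ⟶ A'.X) [IsMonHom π] {Ω : Type u} [Field Ω]
  (s : Spec (.of Ω) ⟶ S)

/-- **`n • π_s^*Θ′` is symmetric on `B_s` when `Θ′` is symmetric on `A′_s`** — for a homomorphism `π : B → A′` of abelian schemes over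
`S` with `π_s` dominant (e.g. an isogeny): the `hΘ₀sym` input of ★ `exists_isAmple_isLambdaOfAt_of_symmetric_witnesses` for the
(X-amp-2) witness `Θ₀ := ν • φ_d^*Θ′_sym`. [cite: MumfordAV1970, §8 (ii)–(iv) (pp. 74–75)] [cite: GortzWedhorn2023, Rem. 27.185 (p. 674)] -/
theorem symmetric_nsmul_pullback_fibreHom [IsDominant (AbelianVariety.Hom.toSchemeHom (fibreHom π s))] (n : ℕ)
    {Θ' : CartierDivisor (A'.fibre s).toAbelianVariety.X.left}
    (hΘ' : (Θ'.classPullback ((𝟙 (A'.fibre s).toAbelianVariety.X)⁻¹ :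
      (A'.fibre s).toAbelianVariety.X ⟶ (A'.fibre s).toAbelianVariety.X).left).LinEquiv Θ') :
    (((n • Θ'.pullback (AbelianVariety.Hom.toSchemeHom (fibreHom π s))).classPullback
        ((𝟙 (B.fibre s).toAbelianVariety.X)⁻¹ : (B.fibre s).toAbelianVariety.X ⟶ (B.fibre s).toAbelianVariety.X).left)).LinEquiv
      (n • Θ'.pullback (AbelianVariety.Hom.toSchemeHom (fibreHom π s))) :=
  symmetric_nsmul (symmetric_pullback_toSchemeHom (fibreHom π s) hΘ') n

end Literature.AlgebraicGeometry.AbelianSchemes.AbelianSchemeOver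

end
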